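import Mathlib

/-!
# Imbrie (2016), the three-spin block: FULLY UMBILIC pair planes

[cite: ImbrieJSP2016, eq. (1.1), assumption LLA(ν, C)]  Repair cell b2b-imbrie, LLA.md block P
(gen 8), P4 "umbilic census".  In the three-spin block `H = D + t₁X₁ + t₂X₂ + t₃X₃` of
[ImbrieJSP2016, eq. (1.1)] (landscape `D`, notation of `FlatPair`) the level-repulsion engine of
block O/P differentiates a resonant pair of levels along ONE random parameter at a time; the
available directions are the eleven operators
`𝒜 = {Π_{(σ₁,σ₂)} (4 bond-1 cells), Π_{(σ₂,σ₃)} (4 bond-2 cells), X₁, X₂, X₃}`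
and a direction `A` splits the pair at first order iff the compression of `A` to the pair plane is
NOT scalar.  `FlatPair` showed that the x-polarised pair is flat for the eight CELLS (but `X₁`, `X₃`
split it).  This file records the two configurations where even the three transverse fields fail:

* `Ω₁ s = |+,s,−⟩ + |−,s,+⟩`, `Ω₂ s = |−,s,−⟩ − |+,s,+⟩` (one σ₂-sector): every cell projection is
  scalar on `span{Ω₁, Ω₂}` AND the whole transverse part compresses to ZERO on it, for all
  `t₁ t₂ t₃`; and on the codimension-two classical set `h₁ + J₁ s = 0`, `h₃ + J₂ s = 0` the plane
  lies in a (four-fold) degenerate eigenspace of the landscape.  So at `t = 0` there the pair is an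
  exact degenerate eigenpair of `H` that NO single parameter of the model moves apart at first order.
* `Ξ₁ = Σ_{σ₁σ₂σ₃ = +1} σ₁ |σ⟩`, `Ξ₂ = Σ_{σ₁σ₂σ₃ = −1} σ₁σ₂ |σ⟩`: again all eleven compressions are
  scalar, and `span{Ξ₁, Ξ₂}` lies in the kernel of `X₁ + X₃` (the pure transverse point
  `D = 0`, `t₂ = 0`, `t₁ = t₃`).

Consequence (LLA.md P4): the uniform "eleven-direction spread lemma" is false as a pointwise
statement; its exceptional set is classified there (these two families, up to the symmetries of
the block), and only a measure-weighted version can hold.  Finite identities over the 8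
configurations; no analysis.  The file is self-contained like its siblings: the conventions
(`sgn`, `Ket`, `transverse`, `landscape`, `diag`, `inner`) are restated verbatim from `FlatPair`,
and the states are written as polynomial expressions in the spin values `sgn`.
-/

namespace Literature.MathematicalPhysics.QuantumLattice.Imbrie2016

open Finset BigOperators

namespace UmbilicPlanes

/-- [cite: ImbrieJSP2016, eq. (1.1)] spin value of a basis index: `0 ↦ +1`, `1 ↦ −1` (as in `FlatPair`). -/
def sgn (a : Fin 2) : ℝ := if a = 0 then 1 else -1

/-- [cite: ImbrieJSP2016, eq. (1.1)] three-spin kets as real functions of the three basis indices (as in `FlatPair`). -/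
abbrev Ket := Fin 2 → Fin 2 → Fin 2 → ℝ

/-- [cite: ImbrieJSP2016, eq. (1.1)] the transverse part `t₁X₁ + t₂X₂ + t₃X₃` (as in `FlatPair`). -/
def transverse (t₁ t₂ t₃ : ℝ) (ψ : Ket) : Ket :=
  fun a b c => t₁ * ψ a.rev b c + t₂ * ψ a b.rev c + t₃ * ψ a b c.rev

/-- [cite: ImbrieJSP2016, eq. (1.1)] the landscape (diagonal part, shift `c₀` adjoined; as in `FlatPair`). -/
def landscape (c₀ h₁ h₂ h₃ J₁ J₂ : ℝ) (a b c : Fin 2) : ℝ :=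
  c₀ + h₁ * sgn a + h₂ * sgn b + h₃ * sgn c + J₁ * sgn a * sgn b + J₂ * sgn b * sgn c

/-- [cite: ImbrieJSP2016, eq. (1.1)] multiplication by the landscape (as in `FlatPair`). -/
def diag (c₀ h₁ h₂ h₃ J₁ J₂ : ℝ) (ψ : Ket) : Ket :=
  fun a b c => landscape c₀ h₁ h₂ h₃ J₁ J₂ a b c * ψ a b c

/-- [cite: ImbrieJSP2016, eq. (1.1)] real inner product on kets (as in `FlatPair`). -/
def inner (φ ψ : Ket) : ℝ := ∑ a, ∑ b, ∑ c, φ a b c * ψ a b c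


/-- [cite: ImbrieJSP2016, eq. (1.1)] `Ω₁ s = |+,s,−⟩ + |−,s,+⟩` (z-basis, entries 0/1), written as
`[σ₂ = s]·(1 − σ₁σ₃)/2`. -/
noncomputable def Ω₁ (s : Fin 2) : Ket := fun a b c => (1 + sgn b * sgn s) / 2 * ((1 - sgn a * sgn c) / 2)

/-- [cite: ImbrieJSP2016, eq. (1.1)] `Ω₂ s = |−,s,−⟩ − |+,s,+⟩` (z-basis, entries 0/±1), written as
`−σ₁·[σ₂ = s]·(1 + σ₁σ₃)/2`. -/
noncomputable def Ω₂ (s : Fin 2) : Ket := fun a b c => -sgn a * ((1 + sgn b * sgn s) / 2) * ((1 + sgn a * sgn c) / 2)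

/-- [cite: ImbrieJSP2016, eq. (1.1)] the pair `Ω₁, Ω₂` is orthogonal, each member of squared norm 2. -/
theorem inner_Ω (s : Fin 2) :
    inner (Ω₁ s) (Ω₂ s) = 0 ∧ inner (Ω₁ s) (Ω₁ s) = 2 ∧ inner (Ω₂ s) (Ω₂ s) = 2 := by
  fin_cases s <;> refine ⟨?_, ?_, ?_⟩ <;> norm_num [inner, Ω₁, Ω₂, sgn, Fin.sum_univ_two]

/-- [cite: ImbrieJSP2016, eq. (1.1)] TRANSVERSE UMBILICITY of `span{Ω₁, Ω₂}`: the transverse part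
`t₁X₁ + t₂X₂ + t₃X₃` compresses to the ZERO 2×2 matrix on the pair, for all `t`; in particular each
`X_i` is scalar (`= 0`) on the plane and no transverse field splits the pair at first order. -/
theorem transverse_compression_Ω (t₁ t₂ t₃ : ℝ) (s : Fin 2) :
    inner (Ω₁ s) (transverse t₁ t₂ t₃ (Ω₁ s)) = 0 ∧ inner (Ω₂ s) (transverse t₁ t₂ t₃ (Ω₂ s)) = 0 ∧
      inner (Ω₁ s) (transverse t₁ t₂ t₃ (Ω₂ s)) = 0 ∧ inner (Ω₂ s) (transverse t₁ t₂ t₃ (Ω₁ s)) = 0 := by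
  fin_cases s <;> refine ⟨?_, ?_, ?_, ?_⟩ <;> norm_num [inner, transverse, Ω₁, Ω₂, sgn, Fin.sum_univ_two, Fin.rev] <;> ring

/-- [cite: ImbrieJSP2016, eq. (1.1)] CELL UMBILICITY, bond-1 cells `(σ₁,σ₂) = (r₁,r₂)`: zero cross
term and equal diagonal values on the pair `Ω₁, Ω₂`. -/
theorem bondOneCell_umbilic_Ω (s r₁ r₂ : Fin 2) :
    (∑ c, Ω₁ s r₁ r₂ c * Ω₂ s r₁ r₂ c) = 0 ∧
      (∑ c, Ω₁ s r₁ r₂ c * Ω₁ s r₁ r₂ c) = (∑ c, Ω₂ s r₁ r₂ c * Ω₂ s r₁ r₂ c) := by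
  fin_cases s <;> fin_cases r₁ <;> fin_cases r₂ <;> norm_num [Ω₁, Ω₂, sgn, Fin.sum_univ_two]

/-- [cite: ImbrieJSP2016, eq. (1.1)] CELL UMBILICITY, bond-2 cells `(σ₂,σ₃) = (r₂,r₃)`: zero cross
term and equal diagonal values on the pair `Ω₁, Ω₂`. -/
theorem bondTwoCell_umbilic_Ω (s r₂ r₃ : Fin 2) :
    (∑ a, Ω₁ s a r₂ r₃ * Ω₂ s a r₂ r₃) = 0 ∧
      (∑ a, Ω₁ s a r₂ r₃ * Ω₁ s a r₂ r₃) = (∑ a, Ω₂ s a r₂ r₃ * Ω₂ s a r₂ r₃) := by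
  fin_cases s <;> fin_cases r₂ <;> fin_cases r₃ <;> norm_num [Ω₁, Ω₂, sgn, Fin.sum_univ_two]

/-- [cite: ImbrieJSP2016, eq. (1.1)] DEGENERATE PARENT: on the codimension-two classical set
`h₁ + J₁·s = 0`, `h₃ + J₂·s = 0` (the four configurations of the σ₂ = s sector have the common energy
`c₀ + h₂ s`) both `Ω₁ s` and `Ω₂ s` are eigenvectors of the landscape with that eigenvalue; hence at
`t = 0` the umbilic plane is an exact degenerate eigenplane of `H`. -/
theorem landscape_eigen_Ω (c₀ h₁ h₂ h₃ J₁ J₂ : ℝ) (s : Fin 2)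
    (hb : h₁ + J₁ * sgn s = 0) (hv : h₃ + J₂ * sgn s = 0) :
    diag c₀ h₁ h₂ h₃ J₁ J₂ (Ω₁ s) = (fun a b c => (c₀ + h₂ * sgn s) * Ω₁ s a b c) ∧
      diag c₀ h₁ h₂ h₃ J₁ J₂ (Ω₂ s) = fun a b c => (c₀ + h₂ * sgn s) * Ω₂ s a b c := by
  refine ⟨?_, ?_⟩ <;> funext a b c <;> fin_cases s <;> fin_cases a <;> fin_cases b <;> fin_cases c <;>
    norm_num [diag, landscape, Ω₁, Ω₂, sgn] at hb hv ⊢ <;> linarith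

/-- [cite: ImbrieJSP2016, eq. (1.1)] `Ξ₁ = Σ_{σ₁σ₂σ₃ = +1} σ₁ |σ⟩` (entries 0/±1), written as `σ₁(1 + σ₁σ₂σ₃)/2`. -/
noncomputable def Ξ₁ : Ket := fun a b c => sgn a * ((1 + sgn a * sgn b * sgn c) / 2)

/-- [cite: ImbrieJSP2016, eq. (1.1)] `Ξ₂ = Σ_{σ₁σ₂σ₃ = −1} σ₁σ₂ |σ⟩` (entries 0/±1), written as `σ₁σ₂(1 − σ₁σ₂σ₃)/2`. -/
noncomputable def Ξ₂ : Ket := fun a b c => sgn a * sgn b * ((1 - sgn a * sgn b * sgn c) / 2)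

/-- [cite: ImbrieJSP2016, eq. (1.1)] the pair `Ξ₁, Ξ₂` is orthogonal, each member of squared norm 4. -/
theorem inner_Ξ : inner Ξ₁ Ξ₂ = 0 ∧ inner Ξ₁ Ξ₁ = 4 ∧ inner Ξ₂ Ξ₂ = 4 := by
  refine ⟨?_, ?_, ?_⟩ <;> norm_num [inner, Ξ₁, Ξ₂, sgn, Fin.sum_univ_two]

/-- [cite: ImbrieJSP2016, eq. (1.1)] TRANSVERSE UMBILICITY of `span{Ξ₁, Ξ₂}`: the transverse part
compresses to zero on the pair for all `t₁ t₂ t₃`. -/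
theorem transverse_compression_Ξ (t₁ t₂ t₃ : ℝ) :
    inner Ξ₁ (transverse t₁ t₂ t₃ Ξ₁) = 0 ∧ inner Ξ₂ (transverse t₁ t₂ t₃ Ξ₂) = 0 ∧
      inner Ξ₁ (transverse t₁ t₂ t₃ Ξ₂) = 0 ∧ inner Ξ₂ (transverse t₁ t₂ t₃ Ξ₁) = 0 := by
  refine ⟨?_, ?_, ?_, ?_⟩ <;> norm_num [inner, transverse, Ξ₁, Ξ₂, sgn, Fin.sum_univ_two, Fin.rev] <;> ring

/-- [cite: ImbrieJSP2016, eq. (1.1)] CELL UMBILICITY of `span{Ξ₁, Ξ₂}`, bond-1 cells: zero cross term,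
both diagonal values equal to 1. -/
theorem bondOneCell_umbilic_Ξ (r₁ r₂ : Fin 2) :
    (∑ c, Ξ₁ r₁ r₂ c * Ξ₂ r₁ r₂ c) = 0 ∧
      (∑ c, Ξ₁ r₁ r₂ c * Ξ₁ r₁ r₂ c) = 1 ∧ (∑ c, Ξ₂ r₁ r₂ c * Ξ₂ r₁ r₂ c) = 1 := by
  fin_cases r₁ <;> fin_cases r₂ <;> norm_num [Ξ₁, Ξ₂, sgn, Fin.sum_univ_two]

/-- [cite: ImbrieJSP2016, eq. (1.1)] CELL UMBILICITY of `span{Ξ₁, Ξ₂}`, bond-2 cells: zero cross term,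
both diagonal values equal to 1. -/
theorem bondTwoCell_umbilic_Ξ (r₂ r₃ : Fin 2) :
    (∑ a, Ξ₁ a r₂ r₃ * Ξ₂ a r₂ r₃) = 0 ∧
      (∑ a, Ξ₁ a r₂ r₃ * Ξ₁ a r₂ r₃) = 1 ∧ (∑ a, Ξ₂ a r₂ r₃ * Ξ₂ a r₂ r₃) = 1 := by
  fin_cases r₂ <;> fin_cases r₃ <;> norm_num [Ξ₁, Ξ₂, sgn, Fin.sum_univ_two]

/-- [cite: ImbrieJSP2016, eq. (1.1)] DEGENERATE PARENT: `Ξ₁`, `Ξ₂` lie in the kernel of `X₁ + X₃`, i.e.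
the transverse part with `t₂ = 0`, `t₁ = t₃ = t` annihilates both (a four-fold degenerate eigenvalue
of the pure transverse point `D = 0`). -/
theorem transverse_kernel_Ξ (t : ℝ) :
    transverse t 0 t Ξ₁ = (fun _ _ _ => 0) ∧ transverse t 0 t Ξ₂ = fun _ _ _ => 0 := by
  refine ⟨?_, ?_⟩ <;> funext a b c <;> fin_cases a <;> fin_cases b <;> fin_cases c <;>
    norm_num [transverse, Ξ₁, Ξ₂, sgn, Fin.rev]

end UmbilicPlanes

end Literature.MathematicalPhysics.QuantumLattice.Imbrie2016
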